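import Summits.SmoothPoincare4.SmoothPoincare4.Theorems.CongruenceShadowsShadowsStandardHelperTopGateOfMonodromy
import HarnessLib

/-!
# `TopGate` from SHADOW-VISIBLE alternating monodromy — helper `helper_topGateOfMonodromyRel` of line
`prym-layer-stable-rank` for crux `CongruenceShadows.ShadowsStandard` (item stmt-SmoothPoincare4-14593,
route route-SmoothPoincare4-CongruenceShadows)

Lead seat c3 reshape of the registered conjecture-grade stub `stub_topMonodromy` (lead c2, v5). That stub
asked for 3-cycle (alternating) monodromy of `Aut S` on the maximal normal overgroups of EVERY maximal
characteristic level `M` of `S = SurfaceGroup (3+3m)` with non-abelian quotient `S/M ≅ T^O`. At a level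
whose factors `S ↠ T` carry a class `c ∈ H₂(T;ℤ)` with `−c ∉ Aut(T)·c` the sign of the class is a
two-block system of imprimitivity for the action of `Aut S` (orientation-reversing automorphisms swap the
blocks), so no automorphism realises a 3-cycle straddling the blocks: the stub as stated is refuted as
soon as one finite simple group has such a class (informal evidence `topMonodromy-audit.md` on the item).
Such levels are invisible to shadows — a homomorphism killing a handlebody kernel factors through the
free group `S/Nᵢ ≅ F_g`, hence has class `0` — i.e. there `Nᵢ ⊔ M = ⊤` for all `i`, and the TOP GATE is
trivially true. This file proves the gate from the monodromy statement RESTRICTED to shadow-visible levels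
(`∃ i, Nᵢ ⊔ M ≠ ⊤`), which is the reshaped registered stub `stub_topMonodromyRel`; the composition of
the line is unchanged. Sorry-free; declares theorems only.
-/

set_option linter.dupNamespace false

noncomputable section

namespace Summit.SmoothPoincare4.SmoothPoincare4.Theorems.ShadowsStandard.PrymLayerStableRank

open Literature.Topology.FourManifolds
open Subgroup

/-! ## The top-stratum gate from shadow-visible 3-cycle monodromy -/

/-- **`TopGate` from shadow-visible monodromy** (line `prym-layer-stable-rank`, lead c3 reshape): if at
every maximal characteristic level `M` of `S = SurfaceGroup (3+3m)` with non-abelian quotient AT WHICH THE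
STANDARD SHADOW IS NON-TRIVIAL (`Nᵢ ⊔ M ≠ ⊤` for some `i`) EITHER there are at least `8` maximal normal
overgroups of `M` and every 3-cycle of them is realised by an automorphism of `S` OR there are at most `2`
of them, then the K-free TOP GATE of the line holds at every maximal characteristic non-abelian level:
every covering triple of normal overgroups of `M` pairwise `Aut S`-equivalent to the standard shadow
triple `(Nᵢ ⊔ M)ᵢ` is simultaneously equivalent to it (at shadow-trivial levels the triple is `(⊤,⊤,⊤)`
and the identity works). [folklore] -/
theorem topGate_of_monodromyRel
    (hAlt : ∀ (m : ℕ) (M : Subgroup (SurfaceGroup (3 + 3 * m))), M.Characteristic → M.FiniteIndex →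
      (∀ X : Subgroup (SurfaceGroup (3 + 3 * m)), X.Characteristic → M < X → X = ⊤) →
      ¬ ⁅(⊤ : Subgroup (SurfaceGroup (3 + 3 * m))), (⊤ : Subgroup (SurfaceGroup (3 + 3 * m)))⁆ ≤ M →
      (∃ i : Fin 3, s4Kernels.stabilizeIter m i ⊔ M ≠ ⊤) →
      (8 ≤ {P : Subgroup (SurfaceGroup (3 + 3 * m)) | P.Normal ∧ M ≤ P ∧ P ≠ ⊤ ∧
            ∀ Q : Subgroup (SurfaceGroup (3 + 3 * m)), Q.Normal → P ≤ Q → Q = P ∨ Q = ⊤}.ncard ∧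
        ∀ P₁ P₂ P₃ : Subgroup (SurfaceGroup (3 + 3 * m)),
          (P₁.Normal ∧ M ≤ P₁ ∧ P₁ ≠ ⊤ ∧
            ∀ Q : Subgroup (SurfaceGroup (3 + 3 * m)), Q.Normal → P₁ ≤ Q → Q = P₁ ∨ Q = ⊤) →
          (P₂.Normal ∧ M ≤ P₂ ∧ P₂ ≠ ⊤ ∧
            ∀ Q : Subgroup (SurfaceGroup (3 + 3 * m)), Q.Normal → P₂ ≤ Q → Q = P₂ ∨ Q = ⊤) →
          (P₃.Normal ∧ M ≤ P₃ ∧ P₃ ≠ ⊤ ∧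
            ∀ Q : Subgroup (SurfaceGroup (3 + 3 * m)), Q.Normal → P₃ ≤ Q → Q = P₃ ∨ Q = ⊤) →
          P₁ ≠ P₂ → P₂ ≠ P₃ → P₁ ≠ P₃ →
          ∃ ψ : SurfaceGroup (3 + 3 * m) ≃* SurfaceGroup (3 + 3 * m),
            P₁.map ψ.toMonoidHom = P₂ ∧ P₂.map ψ.toMonoidHom = P₃ ∧ P₃.map ψ.toMonoidHom = P₁ ∧
            ∀ P : Subgroup (SurfaceGroup (3 + 3 * m)),
              (P.Normal ∧ M ≤ P ∧ P ≠ ⊤ ∧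
                ∀ Q : Subgroup (SurfaceGroup (3 + 3 * m)), Q.Normal → P ≤ Q → Q = P ∨ Q = ⊤) →
              P ≠ P₁ → P ≠ P₂ → P ≠ P₃ → P.map ψ.toMonoidHom = P) ∨
      {P : Subgroup (SurfaceGroup (3 + 3 * m)) | P.Normal ∧ M ≤ P ∧ P ≠ ⊤ ∧
          ∀ Q : Subgroup (SurfaceGroup (3 + 3 * m)), Q.Normal → P ≤ Q → Q = P ∨ Q = ⊤}.ncard ≤ 2) :
    ∀ (m : ℕ) (M : Subgroup (SurfaceGroup (3 + 3 * m))), M.Characteristic → M.FiniteIndex →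
      (∀ X : Subgroup (SurfaceGroup (3 + 3 * m)), X.Characteristic → M < X → X = ⊤) →
      ¬ ⁅(⊤ : Subgroup (SurfaceGroup (3 + 3 * m))), (⊤ : Subgroup (SurfaceGroup (3 + 3 * m)))⁆ ≤ M →
      ∀ Y : Fin 3 → Subgroup (SurfaceGroup (3 + 3 * m)), (∀ i, (Y i).Normal) → (∀ i, M ≤ Y i) →
      (∀ i j : Fin 3, i ≠ j → ∃ α : SurfaceGroup (3 + 3 * m) ≃* SurfaceGroup (3 + 3 * m),
        (s4Kernels.stabilizeIter m i ⊔ M).map α.toMonoidHom = Y i ∧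
          (s4Kernels.stabilizeIter m j ⊔ M).map α.toMonoidHom = Y j) →
      Y 0 ⊔ Y 1 ⊔ Y 2 = ⊤ →
      ∃ ψ : SurfaceGroup (3 + 3 * m) ≃* SurfaceGroup (3 + 3 * m), ∀ i : Fin 3,
        (s4Kernels.stabilizeIter m i ⊔ M).map ψ.toMonoidHom = Y i := by
  intro m M hM hMf hmaxc hnonab Y hYn hMY hpair hcov
  by_cases hvis : ∃ i : Fin 3, s4Kernels.stabilizeIter m i ⊔ M ≠ ⊤
  · haveI : M.Characteristic := hM
    haveI hNn : ∀ i, (s4Kernels.stabilizeIter m i).Normal :=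
      (Summit.SmoothPoincare4.SmoothPoincare4.Theorems.ShadowsStandard.Negative.stabilizeIter_isGroupTrisection
        m).normal
    have hXcov : (s4Kernels.stabilizeIter m 0 ⊔ M) ⊔ (s4Kernels.stabilizeIter m 1 ⊔ M) ⊔
        (s4Kernels.stabilizeIter m 2 ⊔ M) = ⊤ := by
      have h := Summit.SmoothPoincare4.SmoothPoincare4.Theorems.HeegaardHandlebodyCongruenceClosed.PairRigidityRetraction.sup_eq_top_of_isGroupTrisection_punit
        (Summit.SmoothPoincare4.SmoothPoincare4.Theorems.ShadowsStandard.Negative.stabilizeIter_isGroupTrisection m)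
      rw [eq_top_iff, ← h]
      exact sup_le (sup_le (le_sup_left.trans (le_sup_left.trans le_sup_left))
        (le_sup_left.trans (le_sup_right.trans le_sup_left))) (le_sup_left.trans le_sup_right)
    exact gate_of_monodromy M hM hMf hmaxc hnonab (hAlt m M hM hMf hmaxc hnonab hvis)
      (fun i => s4Kernels.stabilizeIter m i ⊔ M) Y (fun i => inferInstance) hYn
      (fun i => le_sup_right) hMY hpair hXcov hcov
  · -- shadow-trivial level: every `Nᵢ ⊔ M = ⊤`, hence every `Y i = ⊤`, and the identity works
    push Not at hvis
    refine ⟨MulEquiv.refl _, fun i => ?_⟩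
    obtain ⟨j, hji⟩ := exists_ne i
    obtain ⟨α, hαi, -⟩ := hpair i j (Ne.symm hji)
    have htop : ∀ β : SurfaceGroup (3 + 3 * m) ≃* SurfaceGroup (3 + 3 * m),
        (⊤ : Subgroup (SurfaceGroup (3 + 3 * m))).map β.toMonoidHom = ⊤ := fun β =>
      Subgroup.map_top_of_surjective _ (MulEquiv.surjective β)
    rw [hvis i] at hαi ⊢
    rw [htop] at hαi ⊢
    exact hαi

/-- **REGISTERED HELPER `helper_topGateOfMonodromyRel`** (line `prym-layer-stable-rank`, lead c3 reshape):
the K-free TOP GATE of the line from 3-cycle monodromy at SHADOW-VISIBLE maximal characteristic non-abelian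
levels only (`∀`-form of `topGate_of_monodromyRel`). [folklore] -/
theorem helper_topGateOfMonodromyRel :
    (∀ (m : ℕ) (M : Subgroup (SurfaceGroup (3 + 3 * m))), M.Characteristic → M.FiniteIndex →
      (∀ X : Subgroup (SurfaceGroup (3 + 3 * m)), X.Characteristic → M < X → X = ⊤) →
      ¬ ⁅(⊤ : Subgroup (SurfaceGroup (3 + 3 * m))), (⊤ : Subgroup (SurfaceGroup (3 + 3 * m)))⁆ ≤ M →
      (∃ i : Fin 3, s4Kernels.stabilizeIter m i ⊔ M ≠ ⊤) →
      (8 ≤ {P : Subgroup (SurfaceGroup (3 + 3 * m)) | P.Normal ∧ M ≤ P ∧ P ≠ ⊤ ∧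
            ∀ Q : Subgroup (SurfaceGroup (3 + 3 * m)), Q.Normal → P ≤ Q → Q = P ∨ Q = ⊤}.ncard ∧
        ∀ P₁ P₂ P₃ : Subgroup (SurfaceGroup (3 + 3 * m)),
          (P₁.Normal ∧ M ≤ P₁ ∧ P₁ ≠ ⊤ ∧
            ∀ Q : Subgroup (SurfaceGroup (3 + 3 * m)), Q.Normal → P₁ ≤ Q → Q = P₁ ∨ Q = ⊤) →
          (P₂.Normal ∧ M ≤ P₂ ∧ P₂ ≠ ⊤ ∧
            ∀ Q : Subgroup (SurfaceGroup (3 + 3 * m)), Q.Normal → P₂ ≤ Q → Q = P₂ ∨ Q = ⊤) →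
          (P₃.Normal ∧ M ≤ P₃ ∧ P₃ ≠ ⊤ ∧
            ∀ Q : Subgroup (SurfaceGroup (3 + 3 * m)), Q.Normal → P₃ ≤ Q → Q = P₃ ∨ Q = ⊤) →
          P₁ ≠ P₂ → P₂ ≠ P₃ → P₁ ≠ P₃ →
          ∃ ψ : SurfaceGroup (3 + 3 * m) ≃* SurfaceGroup (3 + 3 * m),
            P₁.map ψ.toMonoidHom = P₂ ∧ P₂.map ψ.toMonoidHom = P₃ ∧ P₃.map ψ.toMonoidHom = P₁ ∧
            ∀ P : Subgroup (SurfaceGroup (3 + 3 * m)),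
              (P.Normal ∧ M ≤ P ∧ P ≠ ⊤ ∧
                ∀ Q : Subgroup (SurfaceGroup (3 + 3 * m)), Q.Normal → P ≤ Q → Q = P ∨ Q = ⊤) →
              P ≠ P₁ → P ≠ P₂ → P ≠ P₃ → P.map ψ.toMonoidHom = P) ∨
      {P : Subgroup (SurfaceGroup (3 + 3 * m)) | P.Normal ∧ M ≤ P ∧ P ≠ ⊤ ∧
          ∀ Q : Subgroup (SurfaceGroup (3 + 3 * m)), Q.Normal → P ≤ Q → Q = P ∨ Q = ⊤}.ncard ≤ 2) →
    ∀ (m : ℕ) (M : Subgroup (SurfaceGroup (3 + 3 * m))), M.Characteristic → M.FiniteIndex →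
      (∀ X : Subgroup (SurfaceGroup (3 + 3 * m)), X.Characteristic → M < X → X = ⊤) →
      ¬ ⁅(⊤ : Subgroup (SurfaceGroup (3 + 3 * m))), (⊤ : Subgroup (SurfaceGroup (3 + 3 * m)))⁆ ≤ M →
      ∀ Y : Fin 3 → Subgroup (SurfaceGroup (3 + 3 * m)), (∀ i, (Y i).Normal) → (∀ i, M ≤ Y i) →
      (∀ i j : Fin 3, i ≠ j → ∃ α : SurfaceGroup (3 + 3 * m) ≃* SurfaceGroup (3 + 3 * m),
        (s4Kernels.stabilizeIter m i ⊔ M).map α.toMonoidHom = Y i ∧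
          (s4Kernels.stabilizeIter m j ⊔ M).map α.toMonoidHom = Y j) →
      Y 0 ⊔ Y 1 ⊔ Y 2 = ⊤ →
      ∃ ψ : SurfaceGroup (3 + 3 * m) ≃* SurfaceGroup (3 + 3 * m), ∀ i : Fin 3,
        (s4Kernels.stabilizeIter m i ⊔ M).map ψ.toMonoidHom = Y i :=
  fun hAlt => topGate_of_monodromyRel hAlt

end Summit.SmoothPoincare4.SmoothPoincare4.Theorems.ShadowsStandard.PrymLayerStableRank

end
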